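import Summits.ResolutionOfSingularities.ResolutionOfSingularities.Theorems.RankOneTermination.Negative.RankOneTerminationWithoutFG
import Summits.ResolutionOfSingularities.ResolutionOfSingularities.Theorems.RankOneTermination.Negative.MonomialValuationOrder

/-!
# A non-discrete rank-one dimension-zero valuation ring, and `A.FG` is load-bearing — unconditionally

Negative lemma for crux `RankOneTermination` (stmt-ResolutionOfSingularities-17044, route
`SyzygyFlattening`).  The companion file `RankOneTerminationWithoutFG` proved
`rankOneTermination_false_without_FG : H → ¬ (crux with the binder A.FG deleted)` modulo the
hypothesis H = "some prime characteristic admits a rank-one, dimension-zero, NON-Noetherian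
valuation ring `O ⊇ k`".  This file CONSTRUCTS such an `O` over every field `k` and discharges H:

* `wt d = d 0 + d 1 * √2` on exponents `d : Fin 2 →₀ ℕ` is injective (`√2` is irrational),
  additive and monotone; ordering exponents by `wt` is a monomial order `wtOrder` (well-founded
  because weight-bounded sets of exponents are finite);
* `wtValuation k : Valuation (MvPolynomial (Fin 2) k) ℝ≥0`, `f ↦ exp (wt (wtOrder.degree f))`
  (the monomial valuation `x ↦ e, y ↦ e^{√2}` at infinity), extended to the fraction field
  `k(x,y)` as `wtVal k`, with valuation ring `wtRing k`;
* `wtRing k` contains `k` (`algebraMap_mem_wtRing`), has Krull dimension one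
  (`ringKrullDim_wtRing`: not a field, and Archimedean value group), is dimension zero over `k`
  (`dimZero_wtRing`: if `v (a/b) = 1` then `a/b - lc a / lc b` has value `< 1` — cancellation of
  leading terms, `v_sub_smul_lt`), and is NOT Noetherian (`not_isNoetherianRing_wtRing`: a
  principal maximal ideal `(π)` would make `v π` the largest value `< 1`, but Dirichlet
  approximation of `√2` gives monomials `x^j / y^m` of value in `(v π, 1)`, `exists_wtVal_btwn`);
* hence `rankOneTermination_false_without_FG'` : the crux `RankOneTermination` with the single
  binder `A.FG →` deleted is FALSE (take `p = 2`, `k = ZMod 2`, `K = k(x,y)`, `A = O = wtRing k`).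

[topic AlgebraicGeometry/Valuation] — the construction (`wtOrder`, `wtValuation`, `wtVal`,
`wtRing` and their properties) is general-purpose: a rank-one valuation of `k(x,y)/k` with
residue field `k` and value group `ℤ + ℤ√2`, i.e. a non-divisorial, non-discrete zero-dimensional
valuation (Zariski–Samuel VI §10, §15), available for other negative lemmas about valuative
termination statements.
-/

noncomputable section

-- single-problem summit: the doubled namespace component `ResolutionOfSingularities` is forced
set_option linter.dupNamespace false

open MvPolynomial

namespace Summit.ResolutionOfSingularities.ResolutionOfSingularities.Theorems.RankOneTermination.Negative

namespace MonomialValuation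



variable (k : Type) [Field k]

/-! ## Extension to `k(x, y)` and the valuation ring -/

/-- the polynomial ring `k[x,y]` -/
abbrev Pol : Type := MvPolynomial (Fin 2) k
/-- its fraction field `k(x,y)` -/
abbrev RatF : Type := FractionRing (MvPolynomial (Fin 2) k)

/-- Nonzero polynomials lie outside the support of the valuation. [folklore] -/
theorem nonZeroDivisors_le_supp : nonZeroDivisors (Pol k) ≤ (wtValuation k).supp.primeCompl := by
  intro s hs
  have hs0 : s ≠ 0 := nonZeroDivisors.ne_zero hs
  simp only [Ideal.primeCompl, Submonoid.mem_mk, Subsemigroup.mem_mk, Set.mem_compl_iff,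
    SetLike.mem_coe, Valuation.mem_supp_iff, wtValuation_eq_zero_iff]
  exact hs0

/-- The monomial valuation `x ↦ e, y ↦ e^{√2}` on the rational function field `k(x,y)`. -/
def wtVal : Valuation (RatF k) NNReal :=
  (wtValuation k).extendToLocalization (S := nonZeroDivisors (Pol k)) (nonZeroDivisors_le_supp k)
    (RatF k)

/-- The extension restricts to the polynomial valuation. [folklore] -/
theorem wtVal_algebraMap (a : Pol k) : wtVal k (algebraMap (Pol k) (RatF k) a) = wtValuation k a :=
  Valuation.extendToLocalization_apply_map_apply _ _ _ a

/-- Its valuation ring `O ⊂ k(x,y)`: rank one, dimension zero, NOT Noetherian. -/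
def wtRing : ValuationSubring (RatF k) := (wtVal k).valuationSubring

/-- Membership in `O` is `v ≤ 1`. [folklore] -/
theorem mem_wtRing_iff (z : RatF k) : z ∈ wtRing k ↔ wtVal k z ≤ 1 := Iff.rfl

/-- `k ⊆ O`. -/
theorem algebraMap_mem_wtRing (c : k) : algebraMap k (RatF k) c ∈ wtRing k := by
  rw [mem_wtRing_iff, IsScalarTower.algebraMap_apply k (Pol k) (RatF k), wtVal_algebraMap,
    MvPolynomial.algebraMap_eq]
  by_cases hc : c = 0
  · simp [hc]
  · rw [wtValuation_C k hc]

/-- the element `1/x`, of value `e⁻¹ < 1` -/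
def xinv : RatF k := (algebraMap (Pol k) (RatF k) (X 0))⁻¹

/-- Variables are nonzero in `k(x,y)`. [folklore] -/
theorem algebraMap_X_ne_zero (i : Fin 2) : algebraMap (Pol k) (RatF k) (X i) ≠ 0 :=
  fun h => X_ne_zero i ((IsFractionRing.injective (Pol k) (RatF k)) (by rw [h, map_zero]))

/-- The value of a variable in `k(x,y)`. [folklore] -/
theorem wtVal_X (i : Fin 2) : wtVal k (algebraMap (Pol k) (RatF k) (X i)) = expWt (Finsupp.single i 1) := by
  rw [wtVal_algebraMap, wtValuation_X]

/-- Variables have value `> 1`. [folklore] -/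
theorem one_lt_expWt_single (i : Fin 2) : 1 < expWt (Finsupp.single i 1) := by
  rw [← expWt_zero, expWt_lt_iff, wt_zero]
  unfold wt
  fin_cases i
  · simp
  · simp [Real.sqrt_pos]

/-- `1/x` has value `< 1`. [folklore] -/
theorem wtVal_xinv_lt_one : wtVal k (xinv k) < 1 := by
  unfold xinv
  rw [map_inv₀, wtVal_X]
  exact inv_lt_one_of_one_lt₀ (one_lt_expWt_single 0)

/-- `1/x ≠ 0`. [folklore] -/
theorem xinv_ne_zero : xinv k ≠ 0 := inv_ne_zero (algebraMap_X_ne_zero k 0)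

/-- `1/x ∈ O`. [folklore] -/
theorem xinv_mem : xinv k ∈ wtRing k := (wtVal_xinv_lt_one k).le

/-- `O` is the ring of integers of the valuation. [folklore] -/
theorem integers_wtRing : (wtVal k).Integers (wtRing k) :=
  Valuation.valuationSubring.integers (wtVal k)

/-- units of `O` are exactly the elements of value `1` -/
theorem isUnit_iff_wtVal_eq_one (x : wtRing k) : IsUnit x ↔ wtVal k (x : RatF k) = 1 :=
  (integers_wtRing k).isUnit_iff_valuation_eq_one

/-- The maximal ideal of `O` is `{v < 1}`. [folklore] -/
theorem mem_maximalIdeal_iff (x : wtRing k) :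
    x ∈ IsLocalRing.maximalIdeal (wtRing k) ↔ wtVal k (x : RatF k) < 1 := by
  rw [IsLocalRing.mem_maximalIdeal, mem_nonunits_iff, isUnit_iff_wtVal_eq_one]
  have hle : wtVal k (x : RatF k) ≤ 1 := x.2
  exact ⟨fun h => lt_of_le_of_ne hle h, fun h => h.ne⟩

/-- `O` is not a field. -/
theorem not_isField_wtRing : ¬ IsField (wtRing k) := by
  intro hF
  have hx0 : (⟨xinv k, xinv_mem k⟩ : wtRing k) ≠ 0 := by
    intro h
    exact xinv_ne_zero k (congrArg Subtype.val h)
  obtain ⟨y, hy⟩ := hF.mul_inv_cancel hx0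
  have hunit : IsUnit (⟨xinv k, xinv_mem k⟩ : wtRing k) := isUnit_iff_exists_inv.mpr ⟨y, hy⟩
  rw [isUnit_iff_wtVal_eq_one] at hunit
  exact (wtVal_xinv_lt_one k).ne hunit

/-- rank one: the maximal ideal is in the radical of every nonzero principal ideal
(Archimedean value group). -/
theorem maximalIdeal_le_radical (x : wtRing k) (hx : x ≠ 0) :
    IsLocalRing.maximalIdeal (wtRing k) ≤ Ideal.radical (Ideal.span {x}) := by
  intro b hb
  rw [mem_maximalIdeal_iff] at hb
  have hx' : (x : RatF k) ≠ 0 := fun h => hx (Subtype.ext h)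
  have hxpos : 0 < wtVal k (x : RatF k) := pos_iff_ne_zero.mpr ((Valuation.ne_zero_iff _).mpr hx')
  obtain ⟨n, hn⟩ := NNReal.exists_pow_lt_of_lt_one hxpos hb
  refine ⟨n, ?_⟩
  rw [Ideal.mem_span_singleton']
  -- `b^n = w * x` with `w = b^n / x ∈ O`
  have hw : (b : RatF k) ^ n / x ∈ wtRing k := by
    rw [mem_wtRing_iff, map_div₀, map_pow]
    exact (div_le_one₀ hxpos).mpr hn.le
  refine ⟨⟨_, hw⟩, ?_⟩
  apply Subtype.ext
  simp only [MulMemClass.coe_mul, SubmonoidClass.coe_pow]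
  rw [div_mul_cancel₀ _ hx']

/-- **Rank one**: `O` has Krull dimension `1`. [folklore] -/
theorem ringKrullDim_wtRing : ringKrullDim (wtRing k) = 1 :=
  ringKrullDim_eq_one_iff_of_isLocalRing_isDomain.mpr
    ⟨not_isField_wtRing k, fun x hx => maximalIdeal_le_radical k x hx⟩


/-! ## Dimension zero: the residue field is `k` -/

/-- Nonzero polynomials have nonzero value. [folklore] -/
theorem wtValuation_ne_zero {a : Pol k} (ha : a ≠ 0) : wtValuation k a ≠ 0 :=
  fun h => ha ((wtValuation_eq_zero_iff k).mp h)

/-- `DimZero k O`: every element of `O` is, modulo the maximal ideal, algebraic over `k`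
(indeed in `k`: if `v (a/b) = 1` then `a/b - lc a / lc b` has value `< 1`). -/
theorem dimZero_wtRing (y : RatF k) (hy : y ∈ wtRing k) :
    ∃ f : Polynomial k, f ≠ 0 ∧ (wtRing k).valuation (Polynomial.aeval y f) < 1 := by
  have hequiv := (wtVal k).isEquiv_valuation_valuationSubring
  suffices h : ∃ f : Polynomial k, f ≠ 0 ∧ wtVal k (Polynomial.aeval y f) < 1 by
    obtain ⟨f, hf, hlt⟩ := h
    exact ⟨f, hf, (hequiv.lt_one_iff_lt_one).mp hlt⟩
  rw [mem_wtRing_iff] at hy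
  rcases hy.lt_or_eq with hlt | heq
  · exact ⟨Polynomial.X, Polynomial.X_ne_zero, by simpa using hlt⟩
  obtain ⟨a, b, hb, rfl⟩ := IsFractionRing.div_surjective (A := Pol k) y
  have hb0 : b ≠ 0 := nonZeroDivisors.ne_zero hb
  have hbK : algebraMap (Pol k) (RatF k) b ≠ 0 :=
    IsFractionRing.to_map_ne_zero_of_mem_nonZeroDivisors hb
  have hvb : wtValuation k b ≠ 0 := wtValuation_ne_zero k hb0
  have hva : wtValuation k a = wtValuation k b := by
    rw [map_div₀, wtVal_algebraMap, wtVal_algebraMap] at heq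
    exact (div_eq_one_iff_eq hvb).mp heq
  have ha0 : a ≠ 0 := by
    intro h
    rw [h, map_zero] at hva
    exact hvb hva.symm
  have hdeg : wtOrder.degree a = wtOrder.degree b := by
    apply expWt_injective
    rwa [wtValuation_apply, wtValuation_apply, v₀_of_ne_zero k ha0, v₀_of_ne_zero k hb0] at hva
  set c : k := wtOrder.leadingCoeff a / wtOrder.leadingCoeff b with hc
  refine ⟨Polynomial.X - Polynomial.C c, Polynomial.X_sub_C_ne_zero c, ?_⟩
  have hlt := v_sub_smul_lt k ha0 hb0 hdeg
  have hcb : algebraMap (Pol k) (RatF k) (c • b) = algebraMap k (RatF k) c * algebraMap (Pol k) (RatF k) b := by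
    rw [Algebra.smul_def, map_mul, ← IsScalarTower.algebraMap_apply]
  have heval : Polynomial.aeval (algebraMap (Pol k) (RatF k) a / algebraMap (Pol k) (RatF k) b)
      (Polynomial.X - Polynomial.C c)
      = algebraMap (Pol k) (RatF k) (a - c • b) / algebraMap (Pol k) (RatF k) b := by
    simp only [map_sub, Polynomial.aeval_X, Polynomial.aeval_C]
    rw [hcb, sub_div, mul_div_cancel_right₀ _ hbK]
  rw [heval, map_div₀, wtVal_algebraMap, wtVal_algebraMap, ← hva]
  exact NNReal.div_lt_one_of_lt hlt

/-! ## Not Noetherian: the value group `exp (ℤ + ℤ√2)` is dense -/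

/-- The value of `x^n` is `e^n`. [folklore] -/
theorem wtVal_X0_pow (n : ℕ) : ((wtVal k (algebraMap (Pol k) (RatF k) (X 0) ^ n) : NNReal) : ℝ)
    = Real.exp (n : ℝ) := by
  rw [map_pow, wtVal_X, NNReal.coe_pow, coe_expWt]
  have : wt (Finsupp.single (0 : Fin 2) 1) = 1 := by simp [wt]
  rw [this, ← Real.exp_nat_mul, mul_one]

/-- The value of `y^n` is `e^{n√2}`. [folklore] -/
theorem wtVal_X1_pow (n : ℕ) : ((wtVal k (algebraMap (Pol k) (RatF k) (X 1) ^ n) : NNReal) : ℝ)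
    = Real.exp ((n : ℝ) * Real.sqrt 2) := by
  rw [map_pow, wtVal_X, NNReal.coe_pow, coe_expWt]
  have : wt (Finsupp.single (1 : Fin 2) 1) = Real.sqrt 2 := by simp [wt]
  rw [this, ← Real.exp_nat_mul]

/-- For every `0 < ε` there is `z ∈ k(x,y)` with `exp (-ε) < v z < 1`
(Dirichlet approximation of `√2`). -/
theorem exists_wtVal_btwn {ε : ℝ} (hε : 0 < ε) :
    ∃ z : RatF k, Real.exp (-ε) < (wtVal k z : ℝ) ∧ (wtVal k z : ℝ) < 1 := by
  obtain ⟨n, hn⟩ := exists_nat_one_div_lt hε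
  obtain ⟨j, m, hm0, -, hjm⟩ := Real.exists_int_int_abs_mul_sub_le (Real.sqrt 2) (Nat.succ_pos n)
  -- t := m √2 - j ≠ 0, |t| ≤ 1/(n+2) < ε
  set t : ℝ := (m : ℝ) * Real.sqrt 2 - j with ht
  have htne : t ≠ 0 := by
    intro h0
    have hirr := (irrational_iff_ne_rational _).mp irrational_sqrt_two j m (by exact_mod_cast hm0.ne')
    apply hirr
    have hm' : (m : ℝ) ≠ 0 := by exact_mod_cast hm0.ne'
    field_simp
    linarith
  have htabs : |t| < ε := by
    refine lt_of_le_of_lt hjm (lt_of_le_of_lt ?_ hn)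
    gcongr
    linarith
  have htpos : 0 < |t| := abs_pos.mpr htne
  -- `j ≥ 1`
  have hsqrt : (1 : ℝ) < Real.sqrt 2 := by
    rw [show (1 : ℝ) = Real.sqrt 1 by simp]
    exact Real.sqrt_lt_sqrt (by norm_num) (by norm_num)
  have hm1 : (1 : ℝ) ≤ m := by exact_mod_cast hm0
  have hj1 : (1 : ℝ) ≤ j := by
    have h1 : |t| ≤ 1 := by
      refine hjm.trans ?_
      rw [div_le_one (by positivity)]
      linarith
    have : t ≤ 1 := (le_abs_self t).trans h1
    have : (m : ℝ) * Real.sqrt 2 - j ≤ 1 := this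
    have : (m : ℝ) * Real.sqrt 2 ≥ Real.sqrt 2 := by nlinarith
    have hj0 : (0 : ℝ) < j := by nlinarith
    have : (0 : ℤ) < j := by exact_mod_cast hj0
    exact_mod_cast this
  -- natural exponents
  obtain ⟨J, hJ⟩ : ∃ J : ℕ, (J : ℤ) = j := ⟨j.toNat, Int.toNat_of_nonneg (by exact_mod_cast (zero_le_one.trans hj1))⟩
  obtain ⟨Mn, hM⟩ : ∃ Mn : ℕ, (Mn : ℤ) = m := ⟨m.toNat, Int.toNat_of_nonneg hm0.le⟩
  have hJr : (J : ℝ) = j := by exact_mod_cast hJ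
  have hMr : (Mn : ℝ) = m := by exact_mod_cast hM
  set X0 := algebraMap (Pol k) (RatF k) (X 0) with hX0
  set X1 := algebraMap (Pol k) (RatF k) (X 1) with hX1
  have hX0ne : X0 ^ J ≠ 0 := pow_ne_zero _ (algebraMap_X_ne_zero k 0)
  have hX1ne : X1 ^ Mn ≠ 0 := pow_ne_zero _ (algebraMap_X_ne_zero k 1)
  have hv0 : ((wtVal k (X0 ^ J) : NNReal) : ℝ) = Real.exp j := by rw [wtVal_X0_pow, hJr]
  have hv1 : ((wtVal k (X1 ^ Mn) : NNReal) : ℝ) = Real.exp (m * Real.sqrt 2) := by rw [wtVal_X1_pow, hMr]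
  have key : ∀ s : ℝ, s = -|t| → Real.exp (-ε) < Real.exp s ∧ Real.exp s < 1 := by
    intro s hs
    subst hs
    constructor
    · exact Real.exp_lt_exp.mpr (by linarith)
    · rw [← Real.exp_zero]
      exact Real.exp_lt_exp.mpr (by linarith)
  rcases lt_or_gt_of_ne htne with hneg | hpos
  · -- t < 0 : use X1^m / X0^j, value exp (t)
    refine ⟨X1 ^ Mn / X0 ^ J, ?_⟩
    have hval : ((wtVal k (X1 ^ Mn / X0 ^ J) : NNReal) : ℝ) = Real.exp t := by
      rw [map_div₀, NNReal.coe_div, hv0, hv1, ← Real.exp_sub]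
    rw [hval]
    exact key t (by rw [abs_of_neg hneg]; ring)
  · -- t > 0 : use X0^j / X1^m, value exp (-t)
    refine ⟨X0 ^ J / X1 ^ Mn, ?_⟩
    have hval : ((wtVal k (X0 ^ J / X1 ^ Mn) : NNReal) : ℝ) = Real.exp (-t) := by
      rw [map_div₀, NNReal.coe_div, hv0, hv1, ← Real.exp_sub]
      congr 1
      rw [ht]; ring
    rw [hval]
    exact key (-t) (by rw [abs_of_pos hpos])

/-- `O` is not Noetherian (its maximal ideal is not principal, the value group being dense). -/
theorem not_isNoetherianRing_wtRing : ¬ IsNoetherianRing (wtRing k) := by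
  intro hN
  have hfg : (IsLocalRing.maximalIdeal (wtRing k)).FG := IsNoetherian.noetherian _
  obtain ⟨π, hπ⟩ := (IsBezout.isPrincipal_of_FG _ hfg).principal
  have hπmem : π ∈ IsLocalRing.maximalIdeal (wtRing k) := by
    rw [hπ]; exact Ideal.mem_span_singleton_self π
  set r : NNReal := wtVal k (π : RatF k) with hr
  have hr1 : r < 1 := (mem_maximalIdeal_iff k π).mp hπmem
  -- every element of value `< 1` has value `≤ r`
  have hkey : ∀ z : RatF k, wtVal k z < 1 → wtVal k z ≤ r := by
    intro z hz
    have hzm : (⟨z, hz.le⟩ : wtRing k) ∈ IsLocalRing.maximalIdeal (wtRing k) :=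
      (mem_maximalIdeal_iff k _).mpr hz
    rw [hπ, Ideal.mem_span_singleton'] at hzm
    obtain ⟨u, hu⟩ := hzm
    have hzu : z = (u : RatF k) * (π : RatF k) := by
      have := congrArg Subtype.val hu
      simpa using this.symm
    rw [hzu, map_mul]
    exact mul_le_of_le_one_left zero_le u.2
  -- but the value group is dense near `1`
  have hr1' : (r : ℝ) < 1 := by exact_mod_cast hr1
  obtain ⟨z, hz1, hz2⟩ := exists_wtVal_btwn k (ε := 1 - r) (by linarith)
  have hz2' : wtVal k z < 1 := by exact_mod_cast hz2
  have hle : (wtVal k z : ℝ) ≤ r := by exact_mod_cast hkey z hz2'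
  have hexp : (1 : ℝ) - (1 - r) ≤ Real.exp (-(1 - r)) := by
    have := Real.add_one_le_exp (-(1 - (r : ℝ)))
    linarith
  linarith


end MonomialValuation

open Summit.ResolutionOfSingularities.ResolutionOfSingularities.Theorems.SyzygyFlattening
open MonomialValuation

/-- **`A.FG` is load-bearing in `RankOneTermination` — unconditionally.**  The crux
`RankOneTermination` with the single binder `A.FG →` deleted (all other binders verbatim through
the `Iff.rfl` vocabulary `DimZero` / `TowerTerminates` of `SyzygyFlatteningDefs`) is false:
at `p = 2`, `k = ZMod 2`, `K = k(x,y)`, `O = wtRing k` (rank one, dimension zero, not Noetherian)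
and `A := O`, the tower is constantly `O` and never a regular local ring. [folklore] -/
theorem rankOneTermination_false_without_FG' :
    ¬ (∀ p : ℕ, p.Prime → ∀ (k K : Type) [Field k] [CharP k p] [Field K] [Algebra k K]
        (O : ValuationSubring K) (A : Subalgebra k K), (∀ c : k, algebraMap k K c ∈ O) →
        IsFractionRing ↥A K → A.toSubring ≤ O.toSubring → DimZero k O → ringKrullDim ↥O = 1 →
        TowerTerminates O A) :=
  rankOneTermination_false_without_FG
    ⟨2, Nat.prime_two, ZMod 2, RatF (ZMod 2), inferInstance, inferInstance, inferInstance,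
      inferInstance, wtRing (ZMod 2), algebraMap_mem_wtRing (ZMod 2), dimZero_wtRing (ZMod 2),
      ringKrullDim_wtRing (ZMod 2), not_isNoetherianRing_wtRing (ZMod 2)⟩

end Summit.ResolutionOfSingularities.ResolutionOfSingularities.Theorems.RankOneTermination.Negative

end
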